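import Summits.CriticalPhenomena.CardyFormulaZ2.Theorems.StripClusterRates.Negative.KacFromAboveFalse

/-!
# `StripClusterRates` (stmt-CriticalPhenomena-13878), line `two-cluster-rate-is-stationary-gap`:
# the band construction's unconditional upper edge `lim n·γ₂(n) ≤ 144 log 2`

Stub `band_nMul_rateTwo_limit_le` of the band construction for the two-cluster event (lead c5).
The band construction gives `γ₂(3h+3) ≤ 3 γ₁(h)` for every width `h ≥ 1` (taken as a hypothesis
here; it is the content of the sibling stubs). Combined with the tree's RSW bound at odd widths
`γ₁(2j+1) ≤ 8 log 2/(j+1)` (`rateOne_odd_width_le`), along the subsequence `n = 3(2j+1)+3 = 6(j+1)`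
one has `n·γ₂(n) ≤ 18(j+1)·γ₁(2j+1) ≤ 144 log 2`; so every limit `L₂` of `n·γ₂(n)` satisfies
`L₂ ≤ 144 log 2 ≈ 99.8` (`band_nMul_rateTwo_limit_le`). The crux claims `L₂ = 2π ≈ 6.28`.
-/

noncomputable section

open MeasureTheory Filter Topology
open Literature.Probability.LatticeModels Literature.Probability.Percolation
open Summit.CriticalPhenomena.CardyFormulaZ2.Theorems.StripClusterRates.Negative

namespace Summit.CriticalPhenomena.CardyFormulaZ2.Cruxes.StripClusterRates.TwoClusterRateIsStationaryGap

/-- **Upper edge of the window for the two-cluster constant, from the band construction**: if the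
rates `γ₁(n)` of `-log p₁(m,n)/m` exist for `n ≥ 1` and `γ₂(3h+3) ≤ 3γ₁(h)` for all `h ≥ 1`, then
any limit `L₂` of `n·γ₂(n)` satisfies `L₂ ≤ 144 log 2` (along `n = 3(2j+1)+3 = 6(j+1)`:
`n·γ₂(n) ≤ 18(j+1)·γ₁(2j+1) ≤ 18(j+1)·8 log 2/(j+1) = 144 log 2`, by `rateOne_odd_width_le`). [folklore] -/
theorem band_nMul_rateTwo_limit_le : ∀ γ₁ γ₂ : ℕ → ℝ, (∀ n : ℕ, 1 ≤ n → Tendsto (fun m : ℕ ↦ -Real.log (crossingProb half m n) / (m : ℝ)) atTop (𝓝 (γ₁ n))) → (∀ h : ℕ, 1 ≤ h → γ₂ (3 * h + 3) ≤ 3 * γ₁ h) → ∀ L₂ : ℝ, Tendsto (fun n : ℕ ↦ (n : ℝ) * γ₂ n) atTop (𝓝 L₂) → L₂ ≤ 144 * Real.log 2 := by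
  intro γ₁ γ₂ h₁ hband L₂ hL
  -- along the subsequence n = 3(2j+1)+3 = 6(j+1) (band of odd width h = 2j+1 ≥ 1)
  have hsub : Tendsto (fun j : ℕ ↦ 3 * (2 * j + 1) + 3) atTop atTop := by
    refine tendsto_atTop_mono (fun j ↦ ?_) tendsto_id
    simp only [id]; omega
  refine le_of_tendsto' (hL.comp hsub) fun j ↦ ?_
  have hodd : Tendsto (rateSeqOne (2 * j + 1)) atTop (𝓝 (γ₁ (2 * j + 1))) := h₁ (2 * j + 1) (by omega)
  have hγ₁ : γ₁ (2 * j + 1) ≤ 8 * Real.log 2 / (j + 1) := rateOne_odd_width_le hodd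
  have hγ₂ : γ₂ (3 * (2 * j + 1) + 3) ≤ 3 * γ₁ (2 * j + 1) := hband (2 * j + 1) (by omega)
  have hj : (0 : ℝ) < (j : ℝ) + 1 := by positivity
  show ((3 * (2 * j + 1) + 3 : ℕ) : ℝ) * γ₂ (3 * (2 * j + 1) + 3) ≤ 144 * Real.log 2
  have hn : ((3 * (2 * j + 1) + 3 : ℕ) : ℝ) = 6 * ((j : ℝ) + 1) := by push_cast; ring
  rw [hn]
  calc 6 * ((j : ℝ) + 1) * γ₂ (3 * (2 * j + 1) + 3) ≤ 6 * ((j : ℝ) + 1) * (3 * γ₁ (2 * j + 1)) :=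
        mul_le_mul_of_nonneg_left hγ₂ (by positivity)
    _ ≤ 6 * ((j : ℝ) + 1) * (3 * (8 * Real.log 2 / (j + 1))) :=
        mul_le_mul_of_nonneg_left (by linarith) (by positivity)
    _ = 144 * Real.log 2 := by
        field_simp
        ring

end Summit.CriticalPhenomena.CardyFormulaZ2.Cruxes.StripClusterRates.TwoClusterRateIsStationaryGap

end
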